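import Summits.Ventures.AbcSig.Rows.Bridge
import Summits.Ventures.AbcSig.Rows.C2aL241A6
import Summits.Ventures.AbcSig.Rows.C2aL241A6AB

/-!
# Venture AbcSig — CELL `C2aL241A6`: the census statement `Rows.C2aCellRed 241 (fun a => 6 ≤ a) ∅` from the two row theorems

HONEST FRAMING. COMPUTATION cell `pub-abcsig`; CONDITIONAL theorem; no claim on ABC or any summit. Hypotheses exactly as
in `Rows/C2aL241A6.lean` and `Rows/C2aL241A6AB.lean`: `BS04Package` (CITED), `DataComplete …` (COMPUTED level files), and the
rows' per-orbit exclusions for BOTH family predicates (`famB`, `famAB`) as `∀ n a m, …` hypotheses (CITED: the census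
row's certificates). Conclusion = p1's census predicate (`Rows/Statements.lean`), all four coprime coefficient
distributions `A·B = 2^a·241^m`, reduced exponents `a < n`, `m < n` (RULING H1). GENERATED by plean/make_cell_bridges.py.
-/

namespace Summit.Ventures.AbcSig

/-- Cell `C2aL241A6`: `Rows.C2aCellRed 241 (fun a => 6 ≤ a) ∅` under the rows' hypotheses. -/
theorem cell_C2aL241A6 (M : NewformModel) (hP : M.BS04Package)
    (hD241 : M.DataComplete 241 level241Orbits)
    (hD482 : M.DataComplete 482 level482Orbits)
    (hX_orbit_482_5 : ∀ n a m : ℕ, n ∈ ([11] : List ℕ) → M.Excludes 482 orbit_482_5 (famB (2 ^ a * 241 ^ m) n (fun _ _ => True)))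
    (hX_orbit_482_5' : ∀ n a m : ℕ, n ∈ ([11] : List ℕ) → M.Excludes 482 orbit_482_5 (famAB (241 ^ m) (2 ^ a) n (fun _ _ => True))) :
    Rows.C2aCellRed 241 (fun a => 6 ≤ a) ∅ :=
  C2aCellRed_of_rows 241 (by norm_num) (by norm_num) _ _
    (fun n hn h11 hnℓ _ a m ha han hm hmn x y z h1 h2 =>
      row_C2aL241A6 M hP hD241 hD482 n hn h11 hnℓ a m ha hm han hmn (hX_orbit_482_5 n a m) x y z h1 h2)
    (fun n hn h11 hnℓ _ a m ha han hm hmn x y z h1 h2 =>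
      row_C2aL241A6AB M hP hD241 hD482 n hn h11 hnℓ a m ha hm han hmn (hX_orbit_482_5' n a m) x y z h1 h2)

end Summit.Ventures.AbcSig
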